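import Summits.HubbardSuperconductivity.HubbardLadder.Su2WeightZeroReduction
import Literature.MathematicalPhysics.QuantumLattice.SpinChargeKinematics

/-!
# Oct12Representation — the site-permutation representation of `D₄` on the oct12 cluster ([C](b0′), part 1)

HONEST FRAMING: ladder R1–R4 with certified numbers; no claim on H/H₀.  Cell pub-hubbard, lane r2 (g43); conventions memo
`pub-hubbard-r2/clusterrow-g43/lean/CONVENTIONS-b0prime-U.md` (decoded from r2-eng-1's cdata df3d40dc6437d053).
§1 `permOpHom : Equiv.Perm Λ →* Op Λ q` — the Literature permutation operators `permOp` form a monoid hom (covariant for `Equiv.Perm`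
multiplication), with `(permOpHom e)ᴴ = permOpHom e⁻¹`.  §2 the `D₄` action on the twelve oct12 sites (4×4 minus corners, site order of the cut
json b549640712040acb): `r 1 ↦` the rotation `(x,y) ↦ (3−y,x)`, `sr 0 ↦` the axis reflection `(x,y) ↦ (x,3−y)` (= eng-1's `τ`), as a monoid hom
`oct12SiteHom : DihedralGroup 4 →* Equiv.Perm (Fin 12)` whose multiplicativity is decided by the kernel.  §3 the representation
`oct12Rep : DihedralGroup 4 →* Op (Fin 12) q` and `(oct12Rep g)ᴴ = oct12Rep g⁻¹`.  §4 the global flip `flipOp` (involution, Hermitian, commuting with every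
`permOp`), `flipHom : Multiplicative (ZMod 2) →* Op Λ q`, and the FULL representation `oct12SymRep : D₄ × Z₂ →* Op (Fin 12) q` with
`conjTranspose_oct12SymRep : (U g)ᴴ = U g⁻¹` = the hypothesis `hU` of `oct12_pieces` (GroupAlgebraPieces).  §5 the SEAM with the kernel
frames: `permOp_mulVec_single`, `flipOp_mulVec_single`, `oct12SymRep_mulVec_single` (U moves basis configurations to basis configurations)
and `natCast_smul_sum_table_mulVec` (`N • (Σ_g (a g/N) • U g) e = Σ_g a g • U g e` — a signed orbit sum).  All [folklore].
-/

namespace Summit.HubbardSuperconductivity.HubbardLadder.ClusterCut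

open Matrix Literature.MathematicalPhysics.QuantumLattice

/-! ## §1 `permOp` as a monoid hom -/

section PermOpHom

variable {Λ : Type*} [Fintype Λ] [DecidableEq Λ] {q : ℕ}

omit [Fintype Λ] [DecidableEq Λ] in
/-- `configPerm 1 = 1`. [folklore] -/
theorem configPerm_one : configPerm (q := q) (1 : Equiv.Perm Λ) = Equiv.refl _ := by
  ext σ x
  simp

omit [Fintype Λ] [DecidableEq Λ] in
/-- `configPerm (e * f) = (configPerm e).trans (configPerm f)` (note the order: `σ ∘ (e ∘ f) = (σ ∘ e) ∘ f`). [folklore] -/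
theorem configPerm_mul (e f : Equiv.Perm Λ) :
    configPerm (q := q) (e * f) = (configPerm e).trans (configPerm f) := by
  ext σ x
  simp [Equiv.Perm.mul_apply]

omit [DecidableEq Λ] in
/-- `permOp 1 = 1`. [folklore] -/
theorem permOp_one : permOp (q := q) (1 : Equiv.Perm Λ) = 1 := by
  rw [permOp, configPerm_one, Equiv.toPEquiv_refl, PEquiv.toMatrix_refl]

/-- **`permOp` is multiplicative**: `permOp (e * f) = permOp e * permOp f`. [folklore] -/
theorem permOp_mul_permOp (e f : Equiv.Perm Λ) :
    permOp (q := q) (e * f) = permOp e * permOp f := by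
  rw [permOp, permOp, permOp, configPerm_mul, Equiv.toPEquiv_trans, PEquiv.toMatrix_trans]

/-- The permutation operators as a monoid hom `Equiv.Perm Λ →* Op Λ q`. [folklore] -/
noncomputable def permOpHom : Equiv.Perm Λ →* Op Λ q where
  toFun := permOp
  map_one' := permOp_one
  map_mul' := permOp_mul_permOp

/-- Unfolding lemma for `permOpHom`. [folklore] -/
@[simp] theorem permOpHom_apply (e : Equiv.Perm Λ) : permOpHom (q := q) e = permOp e := rfl

/-- Unitarity in the form `algOp` needs: `(permOpHom e)ᴴ = permOpHom e⁻¹`. [folklore] -/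
theorem conjTranspose_permOpHom (e : Equiv.Perm Λ) : (permOpHom (q := q) e)ᴴ = permOpHom e⁻¹ := by
  rw [permOpHom_apply, permOpHom_apply, conjTranspose_permOp]
  rfl

end PermOpHom

/-! ## §2 The `D₄` action on the twelve oct12 sites -/

/-- Rotation `(x,y) ↦ (3−y, x)` of the 4×4-minus-corners cluster, on the site indices of the cut json. -/
def oct12Rot : Equiv.Perm (Fin 12) where
  toFun := ![6, 2, 10, 7, 3, 0, 11, 8, 4, 1, 9, 5]
  invFun := ![5, 9, 1, 4, 8, 11, 0, 3, 7, 10, 2, 6]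
  left_inv := by decide
  right_inv := by decide

/-- Axis reflection `(x,y) ↦ (x, 3−y)` (r2-eng-1's `τ`). -/
def oct12Refl : Equiv.Perm (Fin 12) where
  toFun := ![1, 0, 5, 4, 3, 2, 9, 8, 7, 6, 11, 10]
  invFun := ![1, 0, 5, 4, 3, 2, 9, 8, 7, 6, 11, 10]
  left_inv := by decide
  right_inv := by decide

/-- The site action of `D₄`: `r i ↦ R^i`, `sr i ↦ M * R^i`. -/
def oct12SitePerm : DihedralGroup 4 → Equiv.Perm (Fin 12)
  | DihedralGroup.r i => oct12Rot ^ i.val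
  | DihedralGroup.sr i => oct12Refl * oct12Rot ^ i.val

/-- Multiplicativity of the site action, decided by the kernel on the 8 × 8 table. -/
theorem oct12SitePerm_mul : ∀ g h : DihedralGroup 4, oct12SitePerm (g * h) = oct12SitePerm g * oct12SitePerm h := by
  decide +kernel

/-- The site action sends `1` to the identity permutation (kernel). [folklore] -/
theorem oct12SitePerm_one : oct12SitePerm 1 = 1 := by
  decide +kernel

/-- The site action as a monoid hom `D₄ →* Equiv.Perm (Fin 12)`. -/
def oct12SiteHom : DihedralGroup 4 →* Equiv.Perm (Fin 12) where
  toFun := oct12SitePerm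
  map_one' := oct12SitePerm_one
  map_mul' := oct12SitePerm_mul

/-- Unfolding lemma for `oct12SiteHom`. [folklore] -/
@[simp] theorem oct12SiteHom_apply (g : DihedralGroup 4) : oct12SiteHom g = oct12SitePerm g := rfl

/-- Sanity (kernel): `r 1` is the rotation, `sr 0` the axis reflection, `r 2` the point reflection `(x,y) ↦ (3−x,3−y)`. -/
theorem oct12SitePerm_r2 : (oct12SitePerm (DihedralGroup.r 2) : Fin 12 → Fin 12) = ![11, 10, 9, 8, 7, 6, 5, 4, 3, 2, 1, 0] := by
  decide +kernel

/-! ## §3 The representation on configurations -/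

/-- The oct12 lattice-symmetry representation `D₄ →* Op (Fin 12) q` (site permutations acting on configurations). -/
noncomputable def oct12Rep (q : ℕ) : DihedralGroup 4 →* Op (Fin 12) q :=
  (permOpHom (q := q)).comp oct12SiteHom

/-- Unfolding lemma for `oct12Rep`. [folklore] -/
theorem oct12Rep_apply (q : ℕ) (g : DihedralGroup 4) : oct12Rep q g = permOp (oct12SitePerm g) := rfl

/-- `(oct12Rep g)ᴴ = oct12Rep g⁻¹` — the hypothesis `hU` of `oct12_pieces` for the lattice factor. -/
theorem conjTranspose_oct12Rep (q : ℕ) (g : DihedralGroup 4) : (oct12Rep q g)ᴴ = oct12Rep q g⁻¹ := by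
  rw [oct12Rep, MonoidHom.comp_apply, conjTranspose_permOpHom, ← map_inv, ← MonoidHom.comp_apply]

/-! ## §4 The global spin flip and the full symmetry group `Oct12Sym = D₄ × Z₂` -/

section Flip

variable {Λ : Type*} [Fintype Λ] [DecidableEq Λ] {q : ℕ}

/-- The global flip of configurations `σ ↦ rev ∘ σ` (for `q = 2`: `↑ ↔ ↓` at every site). [folklore] -/
def flipCfgPerm (Λ : Type*) (q : ℕ) : Equiv.Perm (TensorIndex Λ q) :=
  Equiv.arrowCongr (Equiv.refl Λ) Fin.revPerm

omit [Fintype Λ] [DecidableEq Λ] in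
/-- `flipCfgPerm σ = rev ∘ σ`. [folklore] -/
theorem flipCfgPerm_apply (σ : TensorIndex Λ q) : flipCfgPerm Λ q σ = fun x => Fin.rev (σ x) := by
  funext x
  simp [flipCfgPerm, Equiv.arrowCongr]

omit [Fintype Λ] [DecidableEq Λ] in
/-- The flip is an involution on configurations. [folklore] -/
theorem flipCfgPerm_flipCfgPerm (σ : TensorIndex Λ q) : flipCfgPerm Λ q (flipCfgPerm Λ q σ) = σ := by
  rw [flipCfgPerm_apply, flipCfgPerm_apply]
  funext x
  exact Fin.rev_rev _

omit [Fintype Λ] [DecidableEq Λ] in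
/-- The flip squares to `1` in `Equiv.Perm`. [folklore] -/
theorem flipCfgPerm_mul_self : flipCfgPerm Λ q * flipCfgPerm Λ q = 1 := by
  ext σ : 1
  rw [Equiv.Perm.mul_apply, flipCfgPerm_flipCfgPerm, Equiv.Perm.one_apply]

omit [Fintype Λ] [DecidableEq Λ] in
/-- The flip commutes with every site relabelling (as permutations of configurations). [folklore] -/
theorem configPerm_trans_flipCfgPerm (e : Equiv.Perm Λ) :
    (configPerm (q := q) e).trans (flipCfgPerm Λ q) = (flipCfgPerm Λ q).trans (configPerm e) := by
  ext σ x
  simp [flipCfgPerm_apply]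

/-- The global flip operator (a permutation matrix on the product basis). [folklore] -/
noncomputable def flipOp (Λ : Type*) [Fintype Λ] [DecidableEq Λ] (q : ℕ) : Op Λ q :=
  ((flipCfgPerm Λ q).toPEquiv).toMatrix

/-- Entries of the flip operator. [folklore] -/
theorem flipOp_apply (σ τ : TensorIndex Λ q) : flipOp Λ q σ τ = if flipCfgPerm Λ q σ = τ then 1 else 0 := by
  rw [flipOp, PEquiv.toMatrix_apply]
  simp only [Equiv.toPEquiv_apply, Option.mem_def, Option.some.injEq]

/-- `flipOp * flipOp = 1`. [folklore] -/
theorem flipOp_mul_flipOp : flipOp Λ q * flipOp Λ q = 1 := by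
  rw [flipOp, ← PEquiv.toMatrix_trans, ← Equiv.toPEquiv_trans, ← Equiv.Perm.mul_def, flipCfgPerm_mul_self,
    Equiv.Perm.one_def, Equiv.toPEquiv_refl, PEquiv.toMatrix_refl]

/-- `(flipOp)ᴴ = flipOp` (a real symmetric involution). [folklore] -/
theorem conjTranspose_flipOp : (flipOp Λ q)ᴴ = flipOp Λ q := by
  ext σ τ
  rw [conjTranspose_apply, flipOp_apply, flipOp_apply]
  have key : (flipCfgPerm Λ q τ = σ) ↔ (flipCfgPerm Λ q σ = τ) :=
    ⟨fun h => by rw [← h, flipCfgPerm_flipCfgPerm], fun h => by rw [← h, flipCfgPerm_flipCfgPerm]⟩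
  by_cases h : flipCfgPerm Λ q σ = τ
  · rw [if_pos h, if_pos (key.mpr h), star_one]
  · rw [if_neg h, if_neg (fun h' => h (key.mp h')), star_zero]

/-- The flip commutes with every permutation operator. [folklore] -/
theorem permOp_mul_flipOp (e : Equiv.Perm Λ) : permOp (q := q) e * flipOp Λ q = flipOp Λ q * permOp e := by
  rw [flipOp, permOp, ← PEquiv.toMatrix_trans, ← PEquiv.toMatrix_trans, ← Equiv.toPEquiv_trans,
    ← Equiv.toPEquiv_trans, configPerm_trans_flipCfgPerm]

/-- The two elements of `Multiplicative (ZMod 2)`. -/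
theorem zmod2_cases (ε : Multiplicative (ZMod 2)) : ε = 1 ∨ ε = Multiplicative.ofAdd 1 := by
  revert ε
  decide

/-- The generator of `Multiplicative (ZMod 2)` is not `1`. [folklore] -/
theorem zmod2_gen_ne_one : (Multiplicative.ofAdd (1 : ZMod 2)) ≠ 1 := by decide

/-- The generator of `Multiplicative (ZMod 2)` squares to `1`. [folklore] -/
theorem zmod2_gen_mul_self : Multiplicative.ofAdd (1 : ZMod 2) * Multiplicative.ofAdd 1 = 1 := by decide

/-- The flip factor as a monoid hom `Multiplicative (ZMod 2) →* Op Λ q`: `ε ↦ flipOp ^ ε`. [folklore] -/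
noncomputable def flipHom (Λ : Type*) [Fintype Λ] [DecidableEq Λ] (q : ℕ) : Multiplicative (ZMod 2) →* Op Λ q where
  toFun ε := if ε = 1 then 1 else flipOp Λ q
  map_one' := by simp
  map_mul' := by
    have hF := flipOp_mul_flipOp (Λ := Λ) (q := q)
    intro a b
    rcases zmod2_cases a with rfl | rfl <;> rcases zmod2_cases b with rfl | rfl <;>
      simp [zmod2_gen_mul_self, hF]

/-- `flipHom 1 = 1`. [folklore] -/
theorem flipHom_one : flipHom Λ q 1 = 1 := by simp [flipHom]

/-- `flipHom` of the generator is the flip operator. [folklore] -/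
theorem flipHom_gen : flipHom Λ q (Multiplicative.ofAdd 1) = flipOp Λ q := by
  simp [flipHom]

/-- `(flipHom ε)ᴴ = flipHom ε⁻¹`. [folklore] -/
theorem conjTranspose_flipHom (ε : Multiplicative (ZMod 2)) : (flipHom Λ q ε)ᴴ = flipHom Λ q ε⁻¹ := by
  rcases zmod2_cases ε with rfl | rfl
  · rw [inv_one, flipHom_one, conjTranspose_one]
  · have hinv : (Multiplicative.ofAdd (1 : ZMod 2))⁻¹ = Multiplicative.ofAdd 1 := by decide
    rw [hinv, flipHom_gen, conjTranspose_flipOp]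

/-- Every permutation operator commutes with the flip factor. [folklore] -/
theorem permOp_commute_flipHom (e : Equiv.Perm Λ) (ε : Multiplicative (ZMod 2)) :
    Commute (permOp (q := q) e) (flipHom Λ q ε) := by
  rcases zmod2_cases ε with rfl | rfl
  · rw [flipHom_one]; exact Commute.one_right _
  · rw [flipHom_gen]; exact permOp_mul_flipOp e

end Flip

/-- **The full oct12 symmetry representation** `U : Oct12Sym = D₄ × Z₂ →* Op (Fin 12) q`, `U (g, ε) = permOp (site action of g) * flip^ε`. -/
noncomputable def oct12SymRep (q : ℕ) : DihedralGroup 4 × Multiplicative (ZMod 2) →* Op (Fin 12) q :=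
  MonoidHom.noncommCoprod (oct12Rep q) (flipHom (Fin 12) q)
    (fun g ε => by rw [oct12Rep_apply]; exact permOp_commute_flipHom _ _)

/-- Unfolding lemma for `oct12SymRep`: `U (g, ε) = permOp (site action g) * flipHom ε`. [folklore] -/
theorem oct12SymRep_apply (q : ℕ) (g : DihedralGroup 4) (ε : Multiplicative (ZMod 2)) :
    oct12SymRep q (g, ε) = permOp (oct12SitePerm g) * flipHom (Fin 12) q ε := by
  simp [oct12SymRep, MonoidHom.noncommCoprod_apply, oct12Rep_apply]

/-- **`hU` for `oct12_pieces`**: `(U g)ᴴ = U g⁻¹` for the full representation. -/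
theorem conjTranspose_oct12SymRep (q : ℕ) (g : DihedralGroup 4 × Multiplicative (ZMod 2)) :
    (oct12SymRep q g)ᴴ = oct12SymRep q g⁻¹ := by
  obtain ⟨g, ε⟩ := g
  rw [Prod.inv_mk, oct12SymRep_apply, oct12SymRep_apply, conjTranspose_mul, conjTranspose_flipHom,
    ← oct12Rep_apply, conjTranspose_oct12Rep, oct12Rep_apply]
  exact ((permOp_commute_flipHom _ _).eq).symm

/-! ## §5 The seam with the kernel frames: how `U g` moves basis vectors, and `N • P_b e_c` as a signed orbit sum -/

section Seam

variable {Λ : Type*} [Fintype Λ] [DecidableEq Λ] {q : ℕ}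

/-- A permutation operator moves a basis configuration: `permOp e e_c = e_{c ∘ e⁻¹}`. [folklore] -/
theorem permOp_mulVec_single (e : Equiv.Perm Λ) (c : TensorIndex Λ q) :
    permOp (q := q) e *ᵥ Pi.single c 1 = Pi.single (fun x => c (e.symm x)) 1 := by
  funext σ
  rw [permOp_mulVec]
  dsimp only
  have key : ((fun x => σ (e x)) = c) ↔ (σ = fun x => c (e.symm x)) := by
    constructor
    · intro h; funext x; rw [← h]; simp
    · intro h; funext x; rw [h]; simp
  by_cases h : (fun x => σ (e x)) = c
  · rw [h, Pi.single_eq_same, key.mp h, Pi.single_eq_same]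
  · rw [Pi.single_eq_of_ne h, Pi.single_eq_of_ne (fun h' => h (key.mpr h'))]

/-- The flip operator moves a basis configuration: `flipOp e_c = e_{rev ∘ c}`. [folklore] -/
theorem flipOp_mulVec_single (c : TensorIndex Λ q) :
    flipOp Λ q *ᵥ Pi.single c 1 = Pi.single (flipCfgPerm Λ q c) 1 := by
  funext σ
  simp only [Matrix.mulVec, dotProduct, flipOp_apply, ite_mul, one_mul, zero_mul, Finset.sum_ite_eq,
    Finset.mem_univ, if_true]
  have key : (flipCfgPerm Λ q σ = c) ↔ (σ = flipCfgPerm Λ q c) :=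
    ⟨fun h => by rw [← h, flipCfgPerm_flipCfgPerm], fun h => by rw [h, flipCfgPerm_flipCfgPerm]⟩
  by_cases h : flipCfgPerm Λ q σ = c
  · rw [h, Pi.single_eq_same, key.mp h, Pi.single_eq_same]
  · rw [Pi.single_eq_of_ne h, Pi.single_eq_of_ne (fun h' => h (key.mpr h'))]

/-- **Seam lemma** (generic): for integer tables over a common denominator `N ≠ 0`,
`N • ((Σ_g (a g / N) • U g) e) = Σ_g (a g) • (U g e)` — the left side is `N • (algOp U (tableOfInt N a) *ᵥ e)` of
`GroupAlgebraPieces` by `unfold algOp tableOfInt`, the right side is the signed orbit sum the kernel frames are built from. [folklore] -/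
theorem natCast_smul_sum_table_mulVec {ι G : Type*} [Fintype ι] [Fintype G] (U : G → Matrix ι ι ℂ) (N : ℕ) (hN : N ≠ 0)
    (a : G → ℤ) (v : ι → ℂ) :
    ((N : ℂ)) • ((∑ g, (((a g : ℚ) / N : ℚ) : ℂ) • U g) *ᵥ v) = ∑ g, ((a g : ℤ) : ℂ) • (U g *ᵥ v) := by
  rw [Matrix.sum_mulVec, Finset.smul_sum]
  refine Finset.sum_congr rfl fun g _ => ?_
  rw [Matrix.smul_mulVec, smul_smul]
  congr 1
  have hNc : (N : ℂ) ≠ 0 := Nat.cast_ne_zero.mpr hN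
  push_cast
  field_simp

end Seam

/-- **Basis action of the full representation**: `U (g, ε) e_c = e_{c'}` with `c' = flip^ε (c ∘ (site action g)⁻¹)` — so
`Σ_h oct12Table b h • U h e_c` is literally a signed sum of basis configurations (eng-1's `orbitVec`). [folklore] -/
theorem oct12SymRep_mulVec_single (q : ℕ) (g : DihedralGroup 4) (ε : Multiplicative (ZMod 2)) (c : TensorIndex (Fin 12) q) :
    oct12SymRep q (g, ε) *ᵥ Pi.single c 1 =
      Pi.single (if ε = 1 then (fun x => c ((oct12SitePerm g).symm x))
                 else flipCfgPerm (Fin 12) q (fun x => c ((oct12SitePerm g).symm x))) 1 := by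
  rw [oct12SymRep_apply, ((permOp_commute_flipHom (q := q) (oct12SitePerm g) ε).eq), ← Matrix.mulVec_mulVec]
  rcases zmod2_cases ε with rfl | rfl
  · rw [flipHom_one, if_pos rfl, permOp_mulVec_single, Matrix.one_mulVec]
  · rw [flipHom_gen, if_neg zmod2_gen_ne_one, permOp_mulVec_single, flipOp_mulVec_single]

end Summit.HubbardSuperconductivity.HubbardLadder.ClusterCut
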